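import Literature.Analysis.Calculus.CoordinateJets
import Literature.Analysis.Calculus.MultilinearComponentBounds
import Literature.Analysis.FunctionSpaces.HolderOnSetToolkit
import HarnessLib

/-!
# The Gilbarg–Trudinger 17.16 bootstrap, II a: uniform Hölder data along the jets of a family

Part of the a-priori bootstrap of Gilbarg–Trudinger (2001), Lemma 17.16 (see
`Literature/Analysis/PDE/EllipticSmoothBootstrap.lean` for the theorem and
`Literature/Analysis/PDE/EllipticSmoothBootstrapStep.lean` for the linear equations satisfied by
the derivatives).  The interior Schauder estimate
`Literature.Analysis.PDE.exists_schauder_interior_ball` is applied, at each level of the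
bootstrap, to the unknowns `v = D^{n+1}u(·)(e_M)` with coefficients and right-hand sides of the
form `z ↦ Λ(z, θ, cjet_m u(z))`, `Λ` smooth.  This file supplies their `C^α` / `C^{1,α}` data with
constants that are UNIFORM over a family `(θ_k, u_k)` with uniform `C^{m,α}` bounds:

* `holderOnWith_of_norm_sub_le_norm_sub`, `holderOnWith_congr_on`, `holderOnWith_const'` — bookkeeping;
* `holderOnWith_jetMap` — the jet map `z ↦ (z, θ, cjet_m u(z))` is Hölder on a ball with a
  constant depending only on the radius and the `C^{m,α}` bounds of `u`;
* `exists_bound_holder_comp_cjetOf` — a smooth `Λ(y, θ, J)` along the jets of such a family is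
  uniformly bounded and uniformly Hölder (bounded and Lipschitz on the compact convex box
  `B̄(x₀, R) × B̄(0, T) × B̄(0, B_n)` —
  `Literature.Analysis.FunctionSpaces.exists_bound_lipschitzOnWith_of_contDiffOn` — composed
  with the Hölder jet map);
* `norm_apply_cons_le`, `iteratedFDeriv_apply_const_bounds` — the `C^{1,α}` data of the unknowns
  `v(z) = D^{n+1}u(z)(e_{M 0}, …, e_{M n})`.

Everything is fully proved; no named facts.

## References

* D. Gilbarg, N. S. Trudinger, *Elliptic Partial Differential Equations of Second Order*,
  Classics in Mathematics, Springer 2001, Lemma 17.16 and §4.1, §6.1. [GilbargTrudinger2001]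
-/

noncomputable section

open scoped ContDiff Topology NNReal
open Set Function Metric
open Literature.Analysis.Calculus Literature.Analysis.FunctionSpaces

namespace Literature.Analysis.PDE

variable {ι : Type*} [Fintype ι] {E : Type*} [NormedAddCommGroup E] [InnerProductSpace ℝ E]
variable {P : Type*} [NormedAddCommGroup P] [NormedSpace ℝ P]

/-! ### Hölder bookkeeping -/

section Holder

variable {X : Type*} [PseudoMetricSpace X] {s : Set X} {C r : ℝ≥0}

omit [Fintype ι] in
/-- A map that contracts the differences of a Hölder map is Hölder with the same constant.
[folklore] -/
theorem holderOnWith_of_norm_sub_le_norm_sub {F F' : Type*} [NormedAddCommGroup F] [NormedAddCommGroup F']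
    {f : X → F} {g : X → F'} (h : ∀ x ∈ s, ∀ y ∈ s, ‖g x - g y‖ ≤ ‖f x - f y‖)
    (hf : HolderOnWith C r f s) : HolderOnWith C r g s := by
  intro x hx y hy
  refine le_trans ?_ (hf x hx y hy)
  rw [edist_dist, edist_dist, dist_eq_norm, dist_eq_norm]
  exact ENNReal.ofReal_le_ofReal (h x hx y hy)

omit [Fintype ι] in
/-- Functions that agree on `s` are Hölder on `s` together. [folklore] -/
theorem holderOnWith_congr_on {Y : Type*} [PseudoEMetricSpace Y] {f g : X → Y}
    (h : ∀ x ∈ s, f x = g x) (hf : HolderOnWith C r f s) : HolderOnWith C r g s := by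
  intro x hx y hy
  rw [← h x hx, ← h y hy]
  exact hf x hx y hy

omit [Fintype ι] in
/-- Constant maps are Hölder with any constant. [folklore] -/
theorem holderOnWith_const' {Y : Type*} [PseudoEMetricSpace Y] (c : Y) :
    HolderOnWith C r (fun _ : X => c) s := by
  intro x _ y _
  simp

end Holder

/-! ### Smooth functions of the jets of a bounded family are uniformly bounded and Hölder -/

section JetMap

variable [FiniteDimensional ℝ E] [FiniteDimensional ℝ P]

omit [NormedSpace ℝ P] [FiniteDimensional ℝ E] [FiniteDimensional ℝ P] in
/-- **The jet map is Hölder, uniformly**: if `‖Dʲu‖ ≤ B_n` on `B(x₀, r)` for `j ≤ m` and `Dᵐu`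
is `(C, α)`-Hölder there (`α ≤ 1`, `u ∈ C^∞(O)`, `B(x₀, r) ⊆ O`), then
`z ↦ (z, θ, cjet_m u(z))` is `α`-Hölder on `B(x₀, r)` with a constant depending only on
`r, α, B_n, C`. [folklore] -/
theorem holderOnWith_jetMap (bE : OrthonormalBasis ι ℝ E) {m : ℕ} {u : E → ℝ} {O : Set E}
    (hO : IsOpen O) (hu : ContDiffOn ℝ ∞ u O) {x₀ : E} {r : ℝ} (hr : ball x₀ r ⊆ O) {α : ℝ≥0}
    (hα : α ≤ 1) {Bn : ℝ} {C : ℝ≥0} (hB : ∀ z ∈ ball x₀ r, ∀ j ≤ m, ‖iteratedFDeriv ℝ j u z‖ ≤ Bn)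
    (hC : HolderOnWith C α (iteratedFDeriv ℝ m u) (ball x₀ r)) (θ : P) :
    HolderOnWith ((1 + Bn.toNNReal) * (2 * r.toNNReal) ^ (1 - (α : ℝ)) + C) α
      (fun z => (z, θ, cjetOf bE m u z)) (ball x₀ r) := by
  have hid : HolderOnWith ((2 * r.toNNReal) ^ (1 - (α : ℝ))) α (_root_.id : E → E)
      (ball x₀ r) := by
    have h := holderOnWith_of_norm_fderiv_le_ball (f := (_root_.id : E → E)) (x₀ := x₀) (R := r)
      (B := 1) hα differentiableOn_id (fun x _ => by
        rw [fderiv_id]; exact ContinuousLinearMap.norm_id_le.trans (le_of_eq NNReal.coe_one.symm))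
    rwa [one_mul] at h
  have hj : ∀ j ≤ m, HolderOnWith (max (Bn.toNNReal * (2 * r.toNNReal) ^ (1 - (α : ℝ))) C) α
      (iteratedFDeriv ℝ j u) (ball x₀ r) := by
    intro j hjm
    rcases hjm.lt_or_eq with hlt | rfl
    · refine (holderOnWith_of_norm_fderiv_le_ball hα (fun z hz => ?_) (fun z hz => ?_)).mono_const
        (le_max_left _ _)
      · have huz : ContDiffAt ℝ (j + 1 : ℕ) u z :=
          (hu.contDiffAt (hO.mem_nhds (hr hz))).of_le (WithTop.coe_le_coe.2 le_top)
        exact (huz.differentiableAt_iteratedFDeriv (by exact_mod_cast Nat.lt_succ_self j)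
          ).differentiableWithinAt
      · rw [norm_fderiv_iteratedFDeriv]
        exact (hB z hz (j + 1) hlt).trans (Real.le_coe_toNNReal Bn)
    · exact hC.mono_const (le_max_right _ _)
  refine (hid.prodMk ((holderOnWith_const' (C := 0) θ).prodMk
    (holderOnWith_cjetOf bE m u hj))).mono_const (max_le ?_ (max_le zero_le (max_le ?_ ?_)))
  · calc (2 * r.toNNReal) ^ (1 - (α : ℝ)) ≤ (1 + Bn.toNNReal) * (2 * r.toNNReal) ^ (1 - (α : ℝ)) :=
          le_mul_of_one_le_left zero_le le_self_add
      _ ≤ _ := le_self_add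
  · calc Bn.toNNReal * (2 * r.toNNReal) ^ (1 - (α : ℝ))
          ≤ (1 + Bn.toNNReal) * (2 * r.toNNReal) ^ (1 - (α : ℝ)) := by gcongr; exact le_add_self
      _ ≤ _ := le_self_add
  · exact le_add_self

/-- **A smooth function of `(y, θ, J)` along the jets of a bounded family is uniformly bounded
and uniformly Hölder.** Let `Λ` be `C^∞` on `{(y, θ, J) | y ∈ O}`, `B̄(x₀, R) ⊆ O`, `r ≤ R`,
`α ≤ 1`, `0 ≤ B_n`. There are `M_f` and `H_f` such that for every parameter `‖θ‖ ≤ T` and every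
`u ∈ C^∞(O)` with `‖Dʲu‖ ≤ B_n` (`j ≤ m`) on `B(x₀, r)` and `[Dᵐu]_{α; B(x₀, r)} ≤ C`:
`|Λ(z, θ, cjet_m u(z))| ≤ M_f` on `B(x₀, r)` and `z ↦ Λ(z, θ, cjet_m u(z))` is `(H_f, α)`-Hölder
there (`Λ` is bounded and Lipschitz on the compact convex box
`B̄(x₀, R) × B̄(0, T) × B̄(0, B_n)`, and the jet map is Hölder into it). [folklore] -/
theorem exists_bound_holder_comp_cjetOf (bE : OrthonormalBasis ι ℝ E) {m : ℕ}
    {Λ : E × P × CJet ι m → ℝ} {O : Set E} (hO : IsOpen O)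
    (hΛ : ContDiffOn ℝ ∞ Λ {w | w.1 ∈ O}) {x₀ : E} {R r : ℝ} (hRO : closedBall x₀ R ⊆ O)
    (hr : r ≤ R) {α : ℝ≥0} (hα : α ≤ 1) (T : ℝ) {Bn : ℝ} (hBn : 0 ≤ Bn) (C : ℝ≥0) :
    ∃ Mf : ℝ, ∃ Hf : ℝ≥0, ∀ (θ : P) (u : E → ℝ), ‖θ‖ ≤ T → ContDiffOn ℝ ∞ u O →
      (∀ z ∈ ball x₀ r, ∀ j ≤ m, ‖iteratedFDeriv ℝ j u z‖ ≤ Bn) →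
      HolderOnWith C α (iteratedFDeriv ℝ m u) (ball x₀ r) →
      (∀ z ∈ ball x₀ r, ‖Λ (z, θ, cjetOf bE m u z)‖ ≤ Mf) ∧
        HolderOnWith Hf α (fun z => Λ (z, θ, cjetOf bE m u z)) (ball x₀ r) := by
  set K : Set (E × P × CJet ι m) :=
    closedBall x₀ R ×ˢ (closedBall (0 : P) T ×ˢ closedBall (0 : CJet ι m) Bn) with hK
  have hKc : IsCompact K := (isCompact_closedBall x₀ R).prod
    ((isCompact_closedBall (0 : P) T).prod (isCompact_closedBall (0 : CJet ι m) Bn))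
  have hKconv : Convex ℝ K := (convex_closedBall x₀ R).prod
    ((convex_closedBall (0 : P) T).prod (convex_closedBall (0 : CJet ι m) Bn))
  have hKO : K ⊆ {w | w.1 ∈ O} := fun w hw => hRO hw.1
  have hopen : IsOpen {w : E × P × CJet ι m | w.1 ∈ O} := hO.preimage continuous_fst
  obtain ⟨Mf, L, hMf, hL⟩ := exists_bound_lipschitzOnWith_of_contDiffOn hopen
    (hΛ.of_le (WithTop.coe_le_coe.2 le_top)) hKc hKconv hKO
  refine ⟨Mf, L * ((1 + Bn.toNNReal) * (2 * r.toNNReal) ^ (1 - (α : ℝ)) + C),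
    fun θ u hθ hu hB hC => ?_⟩
  have hbr : ball x₀ r ⊆ O :=
    (ball_subset_closedBall.trans (closedBall_subset_closedBall hr)).trans hRO
  have hmaps : MapsTo (fun z => (z, θ, cjetOf bE m u z)) (ball x₀ r) K := by
    intro z hz
    refine ⟨ball_subset_closedBall (ball_subset_ball hr hz), mem_closedBall_zero_iff.2 hθ,
      mem_closedBall_zero_iff.2 (norm_cjetOf_le bE m u z (hB z hz) hBn)⟩
  exact ⟨fun z hz => hMf _ (hmaps hz),
    hL.comp_holderOnWith' (holderOnWith_jetMap bE hO hu hbr hα hB hC θ) hmaps⟩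

end JetMap

/-! ### The unknowns `v = D^{n+1}u(·)(e_M)` of the differentiated equations -/

section Unknown

omit [Fintype ι] [InnerProductSpace ℝ E] in
/-- `‖A(w, M)‖ ≤ ‖A‖ ‖w‖` for a multilinear form and a tuple `M` of vectors of norm `≤ 1`.
[folklore] -/
theorem norm_apply_cons_le [NormedSpace ℝ E] {n : ℕ} (A : E [×(n + 1)]→L[ℝ] ℝ) (w : E)
    {M : Fin n → E} (hM : ∀ t, ‖M t‖ ≤ 1) : ‖A (Fin.cons w M)‖ ≤ ‖A‖ * ‖w‖ := by
  refine (A.le_opNorm _).trans ?_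
  rw [Fin.prod_univ_succ, Fin.cons_zero]
  simp only [Fin.cons_succ]
  calc ‖A‖ * (‖w‖ * ∏ t, ‖M t‖) ≤ ‖A‖ * (‖w‖ * 1) := by
        gcongr
        exact Finset.prod_le_one (fun t _ => norm_nonneg _) fun t _ => hM t
    _ = ‖A‖ * ‖w‖ := by rw [mul_one]

/-- **The `C^{1,α}` data of the unknown `v(z) = D^{n+1}u(z)(e_{M 0}, …, e_{M n})`** on a ball
where `‖D^{n+1}u‖, ‖D^{n+2}u‖ ≤ B_n` and `D^{n+2}u` is `(C, α)`-Hölder: `v` is smooth,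
`|v|, ‖Dv‖ ≤ B_n` and `Dv` is `(C, α)`-Hölder (`Dv(z) w = D^{n+2}u(z)(w, e_M)`, and evaluation
at a tuple of unit vectors has norm `≤ 1`). [folklore] -/
theorem iteratedFDeriv_apply_const_bounds (bE : OrthonormalBasis ι ℝ E) {n : ℕ} {u : E → ℝ}
    {O : Set E} (hO : IsOpen O) (hu : ContDiffOn ℝ ∞ u O) {x₀ : E} {r : ℝ} (hr : ball x₀ r ⊆ O)
    (M : Fin (n + 1) → ι) {Bn : ℝ} {C α : ℝ≥0}
    (hB1 : ∀ z ∈ ball x₀ r, ‖iteratedFDeriv ℝ (n + 1) u z‖ ≤ Bn)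
    (hB2 : ∀ z ∈ ball x₀ r, ‖iteratedFDeriv ℝ (n + 2) u z‖ ≤ Bn)
    (hC : HolderOnWith C α (iteratedFDeriv ℝ (n + 2) u) (ball x₀ r)) :
    ContDiffOn ℝ ∞ (fun z => iteratedFDeriv ℝ (n + 1) u z (fun t => bE (M t))) (ball x₀ r) ∧
    (∀ z ∈ ball x₀ r, ‖iteratedFDeriv ℝ (n + 1) u z (fun t => bE (M t))‖ ≤ Bn) ∧
    (∀ z ∈ ball x₀ r,
      ‖fderiv ℝ (fun z => iteratedFDeriv ℝ (n + 1) u z (fun t => bE (M t))) z‖ ≤ Bn) ∧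
    HolderOnWith C α (fderiv ℝ (fun z => iteratedFDeriv ℝ (n + 1) u z (fun t => bE (M t))))
      (ball x₀ r) := by
  have hM1 : ∀ t, ‖bE (M t)‖ ≤ 1 := fun t => (bE.norm_eq_one (M t)).le
  have hderiv : ∀ z ∈ ball x₀ r, ∀ w,
      fderiv ℝ (fun z => iteratedFDeriv ℝ (n + 1) u z (fun t => bE (M t))) z w =
        iteratedFDeriv ℝ (n + 1 + 1) u z (Fin.cons w (fun t => bE (M t))) := fun z hz w =>
    fderiv_iteratedFDeriv_apply_const
      ((hu.contDiffAt (hO.mem_nhds (hr hz))).of_le (WithTop.coe_le_coe.2 le_top)) _ w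
  refine ⟨(contDiffOn_iteratedFDeriv_apply_const hO hu _).mono hr, fun z hz => ?_,
    fun z hz => ?_, ?_⟩
  · refine ((iteratedFDeriv ℝ (n + 1) u z).le_opNorm _).trans ?_
    rw [Finset.prod_eq_one (fun t _ => bE.orthonormal.1 (M t)), mul_one]
    exact hB1 z hz
  · have h0 : 0 ≤ Bn := (norm_nonneg _).trans (hB1 z hz)
    refine ContinuousLinearMap.opNorm_le_bound _ h0 fun w => ?_
    rw [hderiv z hz w]
    exact (norm_apply_cons_le _ w hM1).trans
      (mul_le_mul_of_nonneg_right (hB2 z hz) (norm_nonneg _))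
  · refine holderOnWith_of_norm_sub_le_norm_sub (f := iteratedFDeriv ℝ (n + 1 + 1) u)
      (fun x hx y hy => ?_) hC
    refine ContinuousLinearMap.opNorm_le_bound _ (norm_nonneg _) fun w => ?_
    rw [_root_.sub_apply, hderiv x hx w, hderiv y hy w, ← _root_.sub_apply]
    exact norm_apply_cons_le _ w hM1

end Unknown

end Literature.Analysis.PDE
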